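import Literature.Analysis.Calculus.ConeCube
import Mathlib.MeasureTheory.Integral.Bochner.ContinuousLinearMap
import Mathlib.MeasureTheory.Function.LocallyIntegrable
import HarnessLib

/-!
# Cone periods: continuity of the integrand, linearity, and equivariance under linear maps

Complements to `Literature/Analysis/Calculus/ConeCube.lean` (cone-cubes `coneCube q x : ℝ^q → W` and
cone periods `conePeriod q ω x = ∫_{[0,1]^q} κ*ω`):

* `continuousOn_conePeriodIntegrand`, `integrableOn_conePeriodIntegrand` — for `ω` continuous on a
  convex set `X` containing the points, the integrand `t ↦ ω(κ t)(∂₀κ, …, ∂_{q-1}κ)` is continuous,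
  hence integrable, on the cube `[0,1]^q`;
* `conePeriod_add`, `conePeriod_smul`, `conePeriod_sum` — linearity in the form;
* `fderiv_coneCube_comp_clm`, `conePeriod_comp_clm` — **equivariance under linear maps**: if
  `ω (A y) (A v₁, …, A v_q) = T (ω' y v)` on `X` for continuous linear `A`, `T`, then
  `conePeriod q ω (A ∘ x) = T (conePeriod q ω' x)` (cone-cubes commute with linear maps on the nose,
  `coneCube_comp_linear`, and `T` commutes with the Bochner integral).

These are the analytic facts behind the equivariance and the Hecke-compatibility of the homogeneous
group cochain `(g₀, …, g_q) ↦ conePeriod q ω (gᵢ • x₀)` attached to an equivariant family of closed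
forms (Dupont's simplicial de Rham map; the Eichler–Shimura–Borel realisation).  Theorems only.

## References

* J. L. Dupont, Topology 15 (1976), §1–2. [Dupont1976]
* R. Sczech, Comment. Math. Helv. 67 (1992), §1–2. [Sczech1992]
-/

noncomputable section

open Set MeasureTheory

namespace Literature.Analysis.Calculus

variable {W : Type*} [NormedAddCommGroup W] [NormedSpace ℝ W]
  {W' : Type*} [NormedAddCommGroup W'] [NormedSpace ℝ W']
  {F : Type*} [NormedAddCommGroup F] [NormedSpace ℝ F]
  {F' : Type*} [NormedAddCommGroup F'] [NormedSpace ℝ F']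

/-! ### The integrand of a cone period is continuous on the cube -/

/-- The tangent vectors `t ↦ (∂₀κ(t), …, ∂_{q-1}κ(t))` of a cone-cube depend continuously on `t`.
[folklore] -/
theorem continuous_fderiv_coneCube_basis (q : ℕ) (x : Fin (q + 1) → W) :
    Continuous fun t : Fin q → ℝ =>
      fun j : Fin q => fderiv ℝ (coneCube q x) t (Pi.single j 1) := by
  have h1 : Continuous (fderiv ℝ (coneCube q x)) :=
    (contDiff_coneCube (n := 1) q x).continuous_fderiv one_ne_zero
  exact continuous_pi fun j => h1.clm_apply continuous_const

/-- **The integrand of a cone period is continuous on the cube** when the form is continuous on a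
convex set containing the points. [folklore] -/
theorem continuousOn_conePeriodIntegrand {X : Set W} (hXc : Convex ℝ X) (q : ℕ)
    {ω : W → W [⋀^Fin q]→L[ℝ] F} (hω : ContinuousOn ω X) {x : Fin (q + 1) → W}
    (hx : ∀ i, x i ∈ X) :
    ContinuousOn (fun t : Fin q → ℝ =>
      ω (coneCube q x t) (fun j => fderiv ℝ (coneCube q x) t (Pi.single j 1))) (Icc 0 1) := by
  have hκ : ContinuousOn (fun t => ω (coneCube q x t)) (Icc (0 : Fin q → ℝ) 1) := by
    refine hω.comp (continuous_coneCube q x).continuousOn fun t ht => ?_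
    exact coneCube_mem_of_convex hXc q hx fun j => ⟨ht.1 j, ht.2 j⟩
  exact continuous_eval.comp_continuousOn
    (hκ.prodMk (continuous_fderiv_coneCube_basis q x).continuousOn)

/-- The integrand of a cone period is integrable on the cube (continuous on a compact set).
[folklore] -/
theorem integrableOn_conePeriodIntegrand {X : Set W} (hXc : Convex ℝ X) (q : ℕ)
    {ω : W → W [⋀^Fin q]→L[ℝ] F} (hω : ContinuousOn ω X) {x : Fin (q + 1) → W}
    (hx : ∀ i, x i ∈ X) :
    IntegrableOn (fun t : Fin q → ℝ =>
      ω (coneCube q x t) (fun j => fderiv ℝ (coneCube q x) t (Pi.single j 1))) (Icc 0 1) :=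
  (continuousOn_conePeriodIntegrand hXc q hω hx).integrableOn_compact isCompact_Icc

/-! ### Linearity in the form -/

/-- Cone periods are additive in the form (both integrands integrable). [folklore] -/
theorem conePeriod_add {X : Set W} (hXc : Convex ℝ X) (q : ℕ)
    {ω₁ ω₂ : W → W [⋀^Fin q]→L[ℝ] F} (h₁ : ContinuousOn ω₁ X) (h₂ : ContinuousOn ω₂ X)
    {x : Fin (q + 1) → W} (hx : ∀ i, x i ∈ X) :
    conePeriod q (ω₁ + ω₂) x = conePeriod q ω₁ x + conePeriod q ω₂ x := by
  simp only [conePeriod_def, Pi.add_apply, ContinuousAlternatingMap.add_apply]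
  exact integral_add (integrableOn_conePeriodIntegrand hXc q h₁ hx)
    (integrableOn_conePeriodIntegrand hXc q h₂ hx)

/-- Cone periods are homogeneous in the form, for any scalar field acting compatibly on the values
(e.g. `ℂ` on a complex Banach space of values). [folklore] -/
theorem conePeriod_smul {𝕜 : Type*} [NontriviallyNormedField 𝕜] [NormedSpace 𝕜 F]
    [SMulCommClass ℝ 𝕜 F] (q : ℕ) (c : 𝕜) (ω : W → W [⋀^Fin q]→L[ℝ] F) (x : Fin (q + 1) → W) :
    conePeriod q (c • ω) x = c • conePeriod q ω x := by
  simp only [conePeriod_def, Pi.smul_apply, ContinuousAlternatingMap.smul_apply]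
  exact integral_smul c _

/-- Cone periods of a finite sum of forms (each continuous on `X`). [folklore] -/
theorem conePeriod_sum {X : Set W} (hXc : Convex ℝ X) (q : ℕ) {ι' : Type*} (s : Finset ι')
    {ω : ι' → W → W [⋀^Fin q]→L[ℝ] F} (hω : ∀ i ∈ s, ContinuousOn (ω i) X)
    {x : Fin (q + 1) → W} (hx : ∀ i, x i ∈ X) :
    conePeriod q (∑ i ∈ s, ω i) x = ∑ i ∈ s, conePeriod q (ω i) x := by
  classical
  induction s using Finset.induction_on with
  | empty =>
      simp [conePeriod_def]
  | insert i s hi ih =>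
      rw [Finset.sum_insert hi, Finset.sum_insert hi,
        conePeriod_add hXc q (hω i (Finset.mem_insert_self i s)) ?_ hx,
        ih fun j hj => hω j (Finset.mem_insert_of_mem hj)]
      rw [Finset.sum_fn]
      exact continuousOn_finsetSum s fun j hj => hω j (Finset.mem_insert_of_mem hj)

/-! ### Equivariance under linear maps -/

/-- The cone-cube of linearly transformed points is the transformed cone-cube (function form of
`coneCube_comp_linear`). [cite: Dupont1976, §1] -/
theorem coneCube_comp_clm (A : W →L[ℝ] W') (q : ℕ) (x : Fin (q + 1) → W) :
    coneCube q (⇑A ∘ x) = ⇑A ∘ coneCube q x :=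
  funext fun t => coneCube_comp_linear A.toLinearMap q x t

/-- Tangent vectors of the transformed cone-cube: `∂ⱼ κ(A x)(t) = A (∂ⱼ κ(x)(t))`. [folklore] -/
theorem fderiv_coneCube_comp_clm (A : W →L[ℝ] W') (q : ℕ) (x : Fin (q + 1) → W) (t v : Fin q → ℝ) :
    fderiv ℝ (coneCube q (⇑A ∘ x)) t v = A (fderiv ℝ (coneCube q x) t v) := by
  rw [coneCube_comp_clm, (A.hasFDerivAt.comp t (differentiable_coneCube q x t).hasFDerivAt).fderiv]
  rfl

/-- **Equivariance of cone periods under linear maps.**  If `A : W → W'` and `T : F → F'` are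
continuous linear and the forms satisfy `ω (A y) (A v₀, …, A v_{q-1}) = T (ω' y v)` for `y` in a
convex set `X` (e.g. `ω = γ ⋆ ω'` for the action of a group element `γ` by `A` on the base and `T` on
the values), then for points of `X`: `conePeriod q ω (A ∘ x) = T (conePeriod q ω' x)`.
[cite: Dupont1976, §1–2] -/
theorem conePeriod_comp_clm [CompleteSpace F] [CompleteSpace F'] {X : Set W} (hXc : Convex ℝ X)
    (q : ℕ) (A : W →L[ℝ] W') (T : F →L[ℝ] F') {ω : W' → W' [⋀^Fin q]→L[ℝ] F'}
    {ω' : W → W [⋀^Fin q]→L[ℝ] F} (hω' : ContinuousOn ω' X)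
    (h : ∀ y ∈ X, ∀ v : Fin q → W, ω (A y) (fun j => A (v j)) = T (ω' y v))
    {x : Fin (q + 1) → W} (hx : ∀ i, x i ∈ X) :
    conePeriod q ω (⇑A ∘ x) = T (conePeriod q ω' x) := by
  rw [conePeriod_def, conePeriod_def,
    ← ContinuousLinearMap.integral_comp_comm T (integrableOn_conePeriodIntegrand hXc q hω' hx)]
  refine setIntegral_congr_fun measurableSet_Icc fun t ht => ?_
  simp only [fderiv_coneCube_comp_clm]
  simp only [coneCube_comp_clm, Function.comp_apply]
  exact h _ (coneCube_mem_of_convex hXc q hx fun j => ⟨ht.1 j, ht.2 j⟩) _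

end Literature.Analysis.Calculus

end
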